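import Summits.AtomisticToContinuum.BoseEinsteinCondensation.Theorems.BECCutLineWeakDisorderGroundStateRigidityStubCellInsertion
import HarnessLib

/-!
# Crux `GroundStateRigidity` (stmt-AtomisticToContinuum-9072), line `insertion_floor`:
# the registered stub `stub_insertion` (Stub I)

Supports (does not close) stmt-AtomisticToContinuum-9072; registered stub `stub_insertion` (Stub I
of line `insertion_floor`; lead c5). **The insertion bound in the Boltzmann frame.** There is an
absolute `A > 0` (here `A = 57`) such that: for `n ≥ 1` bosons in `Λ_L` with a measurable pair
potential of range `≤ R` (`v = 0` beyond `R`, anything below, hard cores allowed), a cell size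
`ℓ ≥ 4R`, `ℓ > 0`, and room `64 (n+1) ℓ³ ≤ L³`, every trial state `Φ` of the `n` particles admits
a normalised `C¹` Dirichlet function `g` of `n+1` particles with
`∫ (|∇g|² + Σ v |g|²) ≤ 𝓔[Φ] + A/ℓ²`.

## Proof

Not by the grid construction of the line card but from the variational principle and the tree's
landed chemical-potential bound for the crux `RigidMomentumBound`
(`RigidMomentumBound.InsertionBound.insertionBound_range_two`, Dyson's Jastrow-dressed insertion,
rescaled by `InsertionScaling.insertionBound_of_fixedRange`; packaged at an arbitrary range as the
landed `CellInsertion.insertionBound_range`). With the range `ℓ/4 ≥ R` and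
`n (ℓ/4)³ ≤ L³/2000` (from `64 (n+1) ℓ³ ≤ L³`) it gives
`E₀(n+1, L) ≤ E₀(n, L) + 120/L² + 13000·n·(ℓ/4)/L³ ≤ E₀(n, L) + 56/ℓ²`
(`L ≥ 5ℓ` since `L³ ≥ 128 ℓ³`). If `𝓔[Φ] = ⊤` any bosonic trial state of `n+1` particles
(`TrialState.nonempty`) will do. Otherwise `E₀(n) ≤ 𝓔[Φ] < ⊤` makes
`E₀(n+1, L) ≤ 𝓔[Φ] + 56/ℓ² < 𝓔[Φ] + 57/ℓ²` strict, and the infimum `E₀(n+1, L)` is approached by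
a bosonic trial state `Ψ` with `𝓔[Ψ] < 𝓔[Φ] + 57/ℓ²`; take `g = Ψ.ψ` (it is `C¹`, Dirichlet,
normalised — and even Bose symmetric).
-/

noncomputable section

open MeasureTheory Filter Metric
open scoped ENNReal NNReal Topology

namespace Summit.AtomisticToContinuum.BoseEinsteinCondensation.Theorems.GroundStateRigidity

open Literature.MathematicalPhysics.QuantumManyBody.BoseGas

namespace Insertion

/-- `L > 0` is forced by `0 < ℓ` and `64 (n+1) ℓ³ ≤ L³`. [folklore] -/
theorem pos_of_room {n : ℕ} {ℓ L : ℝ} (hℓ : 0 < ℓ)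
    (hnL : 64 * ((n : ℝ) + 1) * ℓ ^ 3 ≤ L ^ 3) : 0 < L := by
  have h0 : (0 : ℝ) < 64 * ((n : ℝ) + 1) * ℓ ^ 3 := by positivity
  exact (Odd.pow_pos_iff (by decide : Odd 3)).1 (h0.trans_le hnL)

/-- The density hypothesis at range `ℓ/4`: `64 (n+1) ℓ³ ≤ L³` gives `n (ℓ/4)³ ≤ L³/2000`.
[folklore] -/
theorem density_of_room {n : ℕ} {ℓ L : ℝ} (hℓ : 0 < ℓ)
    (hnL : 64 * ((n : ℝ) + 1) * ℓ ^ 3 ≤ L ^ 3) : (n : ℝ) * (ℓ / 4) ^ 3 ≤ L ^ 3 / 2000 := by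
  have h0 : (0 : ℝ) ≤ n * ℓ ^ 3 := by positivity
  have h1 : (0 : ℝ) ≤ ℓ ^ 3 := by positivity
  rw [le_div_iff₀ (by norm_num : (0 : ℝ) < 2000)]
  calc (n : ℝ) * (ℓ / 4) ^ 3 * 2000 = 125 / 4 * (n * ℓ ^ 3) := by ring
    _ ≤ 64 * ((n : ℝ) + 1) * ℓ ^ 3 := by nlinarith
    _ ≤ L ^ 3 := hnL

/-- The numerical step: for `n ≥ 1`, `0 < ℓ`, `0 < L` and `64 (n+1) ℓ³ ≤ L³`,
`120/L² + 13000·n·(ℓ/4)/L³ ≤ 56/ℓ²` (`L ≥ 5ℓ` as `5³ = 125 ≤ 128`). [folklore] -/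
theorem numeric_bound {n : ℕ} {ℓ L : ℝ} (hn : 1 ≤ n) (hℓ : 0 < ℓ) (hL : 0 < L)
    (hnL : 64 * ((n : ℝ) + 1) * ℓ ^ 3 ≤ L ^ 3) :
    120 / L ^ 2 + 13000 * n * (ℓ / 4) / L ^ 3 ≤ 56 / ℓ ^ 2 := by
  have hn1 : (1 : ℝ) ≤ n := by exact_mod_cast hn
  have hℓ2 : 0 < ℓ ^ 2 := by positivity
  have hℓ3 : 0 < ℓ ^ 3 := by positivity
  have hL3 : 0 < L ^ 3 := by positivity
  have h0 : (0 : ℝ) ≤ n * ℓ ^ 3 := by positivity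
  -- `L ≥ 5 ℓ`
  have hcube : (5 * ℓ) ^ 3 ≤ L ^ 3 := by nlinarith
  have h5 : 5 * ℓ ≤ L := le_of_pow_le_pow_left₀ (by norm_num) hL.le hcube
  have hsq : 25 * ℓ ^ 2 ≤ L ^ 2 := by nlinarith
  have hA : 120 / L ^ 2 ≤ 5 / ℓ ^ 2 := by
    rw [div_le_div_iff₀ (by positivity) hℓ2]
    nlinarith
  have hB : 13000 * n * (ℓ / 4) / L ^ 3 ≤ 51 / ℓ ^ 2 := by
    rw [div_le_div_iff₀ hL3 hℓ2]
    calc 13000 * n * (ℓ / 4) * ℓ ^ 2 = 3250 * (n * ℓ ^ 3) := by ring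
      _ ≤ 51 * (64 * ((n : ℝ) + 1) * ℓ ^ 3) := by nlinarith
      _ ≤ 51 * L ^ 3 := by gcongr
  calc 120 / L ^ 2 + 13000 * n * (ℓ / 4) / L ^ 3 ≤ 5 / ℓ ^ 2 + 51 / ℓ ^ 2 := add_le_add hA hB
    _ = 56 / ℓ ^ 2 := by ring

/-- The chemical-potential bound in the geometry of Stub I: for `n ≥ 1`, `v = 0` beyond `R ≤ ℓ/4`,
`0 < ℓ` and `64 (n+1) ℓ³ ≤ L³`, `E₀(n+1, L) ≤ E₀(n, L) + 56/ℓ²`.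
[cite: LSSY2005, Thm 2.2 (2.17)–(2.26)] -/
theorem groundStateEnergy_succ_le {n : ℕ} {L ℓ R : ℝ} {v : ℝ → ℝ≥0∞} (hn : 1 ≤ n)
    (hv : Measurable v) (hvR : ∀ r : ℝ, R < r → v r = 0) (hRℓ : 4 * R ≤ ℓ) (hℓ : 0 < ℓ)
    (hnL : 64 * ((n : ℝ) + 1) * ℓ ^ 3 ≤ L ^ 3) :
    groundStateEnergy v (n + 1) L ≤ groundStateEnergy v n L + ENNReal.ofReal (56 / ℓ ^ 2) := by
  have hL : 0 < L := pos_of_room hℓ hnL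
  have hc : 0 < ℓ / 4 := by positivity
  have hvc : ∀ r, ℓ / 4 < r → v r = 0 := fun r hr => hvR r (by linarith)
  exact (CellInsertion.insertionBound_range hv hc hvc n hL (density_of_room hℓ hnL)).trans
    (add_le_add_right (ENNReal.ofReal_le_ofReal (numeric_bound hn hℓ hL hnL)) _)

end Insertion

open Insertion in
/-- **Stub I `stub_insertion` of the line `insertion_floor` of the crux `GroundStateRigidity` — the
insertion bound in the Boltzmann frame.** There is an absolute `A` such that: for `n ≥ 1` bosons in
`Λ_L` with a measurable pair potential of range `≤ R` (`v = 0` beyond `R`, anything below, hard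
cores allowed), a cell size `ℓ ≥ 4R` and room for `64(n+1)` cells (`64(n+1)ℓ³ ≤ L³`), every trial
state `Φ` of the `n` particles admits a normalised `C¹` Dirichlet function `g` of `n+1` particles
with `𝓔[g] ≤ 𝓔[Φ] + A/ℓ²`. Proof: the variational principle applied to the chemical-potential
bound `E₀(n+1, L) ≤ E₀(n, L) + 56/ℓ² ≤ 𝓔[Φ] + 56/ℓ² < 𝓔[Φ] + 57/ℓ²`
(`Insertion.groundStateEnergy_succ_le`, from Dyson's Jastrow-dressed insertion
`RigidMomentumBound.InsertionBound.insertionBound_range_two` and scaling); `g` is (the wave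
function of) a near-minimising bosonic trial state of `n+1` particles.
[cite: LSSY2005, Thm 2.2 (2.17)–(2.26)] -/
theorem stub_insertion :
    ∃ A : ℝ, 0 < A ∧ ∀ (n : ℕ) (L ℓ R : ℝ) (v : ℝ → ℝ≥0∞), 1 ≤ n → Measurable v → 0 ≤ R →
      (∀ r : ℝ, R < r → v r = 0) → 4 * R ≤ ℓ → 0 < ℓ → 64 * ((n : ℝ) + 1) * ℓ ^ 3 ≤ L ^ 3 →
      ∀ Φ : TrialState n L, ∃ g : Config (n + 1) → ℂ, ContDiff ℝ 1 g ∧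
        (∀ X, X ∉ boxN (n + 1) L → g X = 0) ∧ ∫⁻ X, (‖g X‖₊ : ℝ≥0∞) ^ 2 = 1 ∧
        ∫⁻ X, kineticDensity g X + interaction v X * (‖g X‖₊ : ℝ≥0∞) ^ 2 ≤
          energy v Φ + ENNReal.ofReal (A / ℓ ^ 2) := by
  refine ⟨57, by norm_num, fun n L ℓ R v hn hv _ hvR hRℓ hℓ hnL Φ => ?_⟩
  have hL : 0 < L := pos_of_room hℓ hnL
  rcases eq_or_ne (energy v Φ) ⊤ with htop | htop
  · -- nothing to prove: any bosonic trial state of `n + 1` particles will do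
    obtain ⟨Ψ⟩ := TrialState.nonempty (Nat.succ_pos n) hL
    refine ⟨Ψ.ψ, Ψ.contDiff, Ψ.eq_zero, Ψ.norm_eq, ?_⟩
    rw [htop, top_add]
    exact le_top
  · have hE : groundStateEnergy v (n + 1) L < energy v Φ + ENNReal.ofReal (57 / ℓ ^ 2) := by
      calc groundStateEnergy v (n + 1) L
          ≤ groundStateEnergy v n L + ENNReal.ofReal (56 / ℓ ^ 2) :=
            groundStateEnergy_succ_le hn hv hvR hRℓ hℓ hnL
        _ ≤ energy v Φ + ENNReal.ofReal (56 / ℓ ^ 2) := by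
            gcongr
            exact iInf_le _ Φ
        _ < energy v Φ + ENNReal.ofReal (57 / ℓ ^ 2) := by
            refine ENNReal.add_lt_add_left htop ((ENNReal.ofReal_lt_ofReal_iff (by positivity)).2 ?_)
            gcongr
            norm_num
    obtain ⟨Ψ, hΨ⟩ := iInf_lt_iff.1 hE
    exact ⟨Ψ.ψ, Ψ.contDiff, Ψ.eq_zero, Ψ.norm_eq, hΨ.le⟩

end Summit.AtomisticToContinuum.BoseEinsteinCondensation.Theorems.GroundStateRigidity

end
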